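import Summits.CriticalPhenomena.CardyFormulaZ2.Theorems.CardyBondTriangularBondTriangularCardyBlueArmCycleContacts
import HarnessLib

/-!
# Route CardyBondTriangular · crux `BondTriangularCardy` · line `birth`: the blue arm of Claim 10 — the main case of the cycle

Helper of the stub `stub_blueArm`; port of `TriClaim10Cycle.cyc_main_false` to the kite walk
(Bollobás–Riordan, *Percolation* (2006), Ch. 7, pp. 178–179: the path `P' ⊆ P₁ ∪ P₂ ∪ S`).
Between an index `r` whose right cell is on the final part `x₂ ⋯ v` of the yellow path or is a
contact with `A₂` (a hexagon yellow towards a dart of the stretch `A₂`), and a later index `s`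
whose right cell is on the initial part `u ⋯ x₁` or is a contact with `A₁`, all right cells in
between being hexagons of `G` off the path: the necklace walk from `ρᵣ` to `ρₛ` (yellow-adjacent
hexagons), made simple and reversed, spliced between the path up to `ρₛ` and the path from `ρᵣ`,
is a yellow path in the Chayes–Lei sense traversing a necklace bond backwards
(`cyc_false_of_reversed_dart`).

## References

* B. Bollobás, O. Riordan, *Percolation*, CUP (2006), Ch. 7, Claim 10 pp. 178–179.
-/

namespace Summit.CriticalPhenomena.CardyFormulaZ2.Theorems.BondTriangularCardyLine.KiteB

open Finset Literature.Probability.Percolation Literature.Probability.LatticeModels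

section Main

variable (D : TriMarkedDomain 3) {σ : CLHexConfig} {w : HexVertex} {orb : ℕ → KDart} {N : ℕ}
  (horb : ∀ k < N, succ (kcol D σ) (orb k) = orb (k + 1))
  (hiface : ∀ k < N, iface (kcol D σ) (orb k) = true) (hadm : ∀ k < N, (orb k).adm = true)
  (hleft : ∀ k < N, (orb k).leftCell ∈ D.verts) (hretG : (orb N).leftCell ∈ D.verts) (hbc0 : (orb 0).leftCorner = w)
  (hnotw : ∀ (Q' : List (Site 2)) (hne : Q' ≠ []), Q'.Nodup → List.IsChain triGraph.Adj Q' →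
    (∀ s ∈ Q', s ∈ D.verts ∧ σ s ≠ CLHexState.B) → (∀ d ∈ pathDarts Q', (clYellowGraph σ).Adj d.1 d.2) →
    ∀ nu' nv' : ℕ, D.pos 1 ≤ nu' → nu' < D.pos 2 → D.pos 2 ≤ nv' → nv' < #(triBdryDarts D.verts) →
    Q'.head hne = (triBdryIter D.verts D.base nu').1 → YellowTowards σ (triBdryIter D.verts D.base nu') →
    Q'.getLast hne = (triBdryIter D.verts D.base nv').1 → YellowTowards σ (triBdryIter D.verts D.base nv') →
    ¬ Separates D.verts {e : Sym2 (Site 2) | ∃ d ∈ pathDarts Q', e = s(d.1, d.2)} w (D.stretch 0))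

/-- **Darts of a prefix are darts of the list** (registered anchor of this file). -/
theorem pathDarts_subset_of_prefix : ∀ {A B : List (Literature.Probability.LatticeModels.Site 2)}, A ≠ [] → ∀ {d : Literature.Probability.LatticeModels.Site 2 × Literature.Probability.LatticeModels.Site 2}, d ∈ Literature.Probability.Percolation.pathDarts A → d ∈ Literature.Probability.Percolation.pathDarts (A ++ B) := by
  intro A B hA d hd
  by_cases hB : B = []
  · subst hB; simpa using hd
  · rw [pathDarts_append hA hB]; exact List.mem_append_left _ hd

/-- Darts of a suffix are darts of the list. -/
theorem pathDarts_subset_of_suffix {A B : List (Site 2)} (hB : B ≠ []) {d : Site 2 × Site 2} (hd : d ∈ pathDarts B) :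
    d ∈ pathDarts (A ++ B) := by
  by_cases hA : A = []
  · subst hA; simpa using hd
  · rw [pathDarts_append hA hB]; exact List.mem_append_right _ (List.mem_cons_of_mem _ hd)

include horb hiface hadm hleft hretG hbc0 hnotw in
/-- **The main case of the cycle** (`TriClaim10Cycle.cyc_main_false` for the kite walk). -/
theorem cyc_main_false {Q L₁ L₂ : List (Site 2)} {a b : Site 2} (hQeq : Q = L₁ ++ a :: b :: L₂) (hQnd : Q.Nodup)
    (hQch : List.IsChain triGraph.Adj Q) (hQG : ∀ s ∈ Q, s ∈ D.verts) (hQB : ∀ s ∈ Q, σ s ≠ CLHexState.B)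
    (hQY : ∀ d ∈ pathDarts Q, (clYellowGraph σ).Adj d.1 d.2)
    {nu nv : ℕ} (hnu1 : D.pos 1 ≤ nu) (hnu2 : nu < D.pos 2) (hnv2 : D.pos 2 ≤ nv) (hnvL : nv < #(triBdryDarts D.verts))
    (hQhead : Q.head (by rw [hQeq]; simp) = (triBdryIter D.verts D.base nu).1)
    (hYu : YellowTowards σ (triBdryIter D.verts D.base nu))
    (hQlast : Q.getLast (by rw [hQeq]; simp) = (triBdryIter D.verts D.base nv).1)
    (hYv : YellowTowards σ (triBdryIter D.verts D.base nv))
    {r s : ℕ} (hrs : r < s) (hsN : s < N)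
    (hmidG : ∀ k, r ≤ k → k ≤ s → (orb k).rightCell ∈ D.verts)
    (hmidQ : ∀ k, r < k → k < s → (orb k).rightCell ∉ Q)
    (hne : (orb r).rightCell ≠ (orb s).rightCell)
    (hsA : (orb s).rightCell ∈ L₁ ++ [a] ∨ ((orb s).rightCell ∉ Q ∧
      ∃ nu', D.pos 1 ≤ nu' ∧ nu' < D.pos 2 ∧ (orb s).rightCell = (triBdryIter D.verts D.base nu').1 ∧
        YellowTowards σ (triBdryIter D.verts D.base nu')))
    (hrT : (orb r).rightCell ∈ b :: L₂ ∨ ((orb r).rightCell ∉ Q ∧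
      ∃ nv', D.pos 2 ≤ nv' ∧ nv' < #(triBdryDarts D.verts) ∧ (orb r).rightCell = (triBdryIter D.verts D.base nv').1 ∧
        YellowTowards σ (triBdryIter D.verts D.base nv'))) :
    False := by
  -- adapted from `TriClaim10Cycle.cyc_main_false` (site version)
  classical
  set L := #(triBdryDarts D.verts) with hL
  set ρ : ℕ → Site 2 := fun k => (orb k).rightCell with hρ
  have hQne : Q ≠ [] := by rw [hQeq]; simp
  obtain ⟨n, rfl⟩ : ∃ n, s = r + n := ⟨s - r, by omega⟩
  -- the necklace walk, made simple
  obtain ⟨W, hWs, hWd⟩ := cyc_exists_necklace_walk D horb hiface hadm hleft r n hsN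
  set Sw := W.bypass with hSw
  have hSpath : Sw.IsPath := W.bypass_isPath
  have hSsupp : ∀ x ∈ Sw.support, ∃ k, r ≤ k ∧ k ≤ r + n ∧ x = ρ k := fun x hx =>
    hWs x (W.support_bypass_subset_support hx)
  have hSdarts : ∀ d ∈ Sw.darts, ∃ k, r ≤ k ∧ k < r + n ∧ ρ k ≠ ρ (k + 1) ∧ d.toProd = (ρ k, ρ (k + 1)) :=
    fun d hd => hWd d (W.darts_bypass_subset_darts hd)
  have hSne : Sw.darts ≠ [] := by
    intro h0
    have : Sw.length = 0 := by rw [← SimpleGraph.Walk.length_darts, h0, List.length_nil]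
    exact hne (SimpleGraph.Walk.eq_of_length_eq_zero this)
  obtain ⟨d₀, hd₀⟩ := List.exists_mem_of_ne_nil _ hSne
  obtain ⟨i, hir, hin, hρi, hd₀eq⟩ := hSdarts d₀ hd₀
  set Snew := Sw.support.reverse with hSnew
  have hSnew_ne : Snew ≠ [] := by simp [hSnew]
  have hSnew_head : Snew.head hSnew_ne = ρ (r + n) := by
    simp only [hSnew, List.head_reverse, SimpleGraph.Walk.getLast_support]; rfl
  have hSnew_last : Snew.getLast hSnew_ne = ρ r := by
    simp only [hSnew, List.getLast_reverse, SimpleGraph.Walk.head_support]; rfl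
  have hSnew_nd : Snew.Nodup := List.nodup_reverse.2 hSpath.support_nodup
  have hSnew_ch : List.IsChain triGraph.Adj Snew := by
    rw [hSnew, List.isChain_reverse]
    exact Sw.isChain_adj_support.imp fun x y h => h.symm
  have hSnew_dart : (ρ (i + 1), ρ i) ∈ pathDarts Snew := by
    rw [hSnew, mem_pathDarts_reverse, mem_pathDarts_support_iff]
    exact ⟨d₀, hd₀, hd₀eq⟩
  have hSnew_mem : ∀ x ∈ Snew, ∃ k, r ≤ k ∧ k ≤ r + n ∧ x = ρ k := fun x hx =>
    hSsupp x (List.mem_reverse.1 hx)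
  have hSnew_GB : ∀ x ∈ Snew, x ∈ D.verts ∧ σ x ≠ CLHexState.B := by
    intro x hx
    obtain ⟨k, h1, h2, rfl⟩ := hSnew_mem x hx
    have hG := hmidG k h1 h2
    exact ⟨hG, rightCell_ne_B (hiface k (by omega)) (hadm k (by omega)) hG⟩
  have hSnew_Y : ∀ d ∈ pathDarts Snew, (clYellowGraph σ).Adj d.1 d.2 := by
    rintro ⟨x, y⟩ hd
    rw [hSnew, mem_pathDarts_reverse, mem_pathDarts_support_iff] at hd
    obtain ⟨e, he, heq⟩ := hd
    obtain ⟨k, h1, h2, hρk, hek⟩ := hSdarts e he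
    rw [hek] at heq
    simp only [Prod.mk.injEq] at heq
    obtain ⟨rfl, rfl⟩ := heq
    exact (cyc_clYellow_adj D horb hiface hadm hleft (show k + 1 < N by omega) hρk (hmidG k h1 (by omega))
      (hmidG (k + 1) (by omega) (by omega))).symm
  have hSnew_len : 2 ≤ Snew.length := by
    rw [hSnew, List.length_reverse, SimpleGraph.Walk.length_support]
    have : 0 < Sw.length := by rw [← SimpleGraph.Walk.length_darts]; exact List.length_pos_iff.2 hSne
    omega
  have hQeq' : Q = (L₁ ++ [a]) ++ (b :: L₂) := by rw [hQeq]; simp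
  have hdisj : ∀ x, x ∈ L₁ ++ [a] → x ∈ b :: L₂ → False := by
    intro x h1 h2
    exact (List.nodup_append.1 (hQeq' ▸ hQnd)).2.2 x h1 x h2 rfl
  -- the prefix `A'` and the suffix `T'`
  have hAex : ∃ A' : List (Site 2), (∀ x ∈ A', x ∈ L₁ ++ [a]) ∧ ρ (r + n) ∉ A' ∧
      List.IsChain triGraph.Adj (A' ++ [ρ (r + n)]) ∧ (A' ++ [ρ (r + n)]).Nodup ∧
      (∀ d ∈ pathDarts (A' ++ [ρ (r + n)]), (clYellowGraph σ).Adj d.1 d.2) ∧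
      (∃ nu', D.pos 1 ≤ nu' ∧ nu' < D.pos 2 ∧ (A' ++ [ρ (r + n)]).head (by simp) = (triBdryIter D.verts D.base nu').1 ∧
        YellowTowards σ (triBdryIter D.verts D.base nu')) := by
    rcases hsA with hA | ⟨-, nu', h1, h2, h3, h4⟩
    · obtain ⟨A', A₂, hsplit⟩ := List.append_of_mem hA
      have hQA : Q = (A' ++ [ρ (r + n)]) ++ (A₂ ++ b :: L₂) := by rw [hQeq', hsplit]; simp [hρ]
      have hndA : (A' ++ [ρ (r + n)]).Nodup := (List.nodup_append.1 (hQA ▸ hQnd)).1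
      refine ⟨A', fun x hx => by rw [hsplit]; simp [hx], ?_, (hQA ▸ hQch).left_of_append, hndA, ?_, nu, hnu1, hnu2, ?_, hYu⟩
      · have := List.nodup_append.1 hndA
        exact fun h => this.2.2 _ h _ (List.mem_singleton_self _) rfl
      · intro d hd
        exact hQY d (by rw [hQA]; exact pathDarts_subset_of_prefix (by simp) hd)
      · rw [← hQhead]
        have key : ∀ (l : List (Site 2)) (hl : l ≠ []), l = (A' ++ [ρ (r + n)]) ++ (A₂ ++ b :: L₂) →
            (A' ++ [ρ (r + n)]).head (by simp) = l.head hl := by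
          intro l hl h; subst h; exact (List.head_append_of_ne_nil (by simp)).symm
        exact key Q _ hQA
    · exact ⟨[], by simp, by simp, List.isChain_singleton _, List.nodup_singleton _, by simp, nu', h1, h2, by simpa using h3, h4⟩
  have hTex : ∃ T' : List (Site 2), (∀ x ∈ T', x ∈ b :: L₂) ∧ ρ r ∉ T' ∧
      List.IsChain triGraph.Adj (ρ r :: T') ∧ (ρ r :: T').Nodup ∧
      (∀ d ∈ pathDarts (ρ r :: T'), (clYellowGraph σ).Adj d.1 d.2) ∧
      (∃ nv', D.pos 2 ≤ nv' ∧ nv' < L ∧ (ρ r :: T').getLast (by simp) = (triBdryIter D.verts D.base nv').1 ∧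
        YellowTowards σ (triBdryIter D.verts D.base nv')) := by
    rcases hrT with hT | ⟨-, nv', h1, h2, h3, h4⟩
    · obtain ⟨T₂, T', hsplit⟩ := List.append_of_mem hT
      have hQT : Q = (L₁ ++ [a] ++ T₂) ++ (ρ r :: T') := by rw [hQeq', hsplit]; simp [hρ]
      have hndT : (ρ r :: T').Nodup := (List.nodup_append.1 (hQT ▸ hQnd)).2.1
      refine ⟨T', fun x hx => by rw [hsplit]; simp [hx], (List.nodup_cons.1 hndT).1, (hQT ▸ hQch).right_of_append,
        hndT, ?_, nv, hnv2, hnvL, ?_, hYv⟩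
      · intro d hd
        exact hQY d (by rw [hQT]; exact pathDarts_subset_of_suffix (by simp) hd)
      · rw [← hQlast]
        have key : ∀ (l : List (Site 2)) (hl : l ≠ []), l = (L₁ ++ [a] ++ T₂) ++ (ρ r :: T') →
            (ρ r :: T').getLast (by simp) = l.getLast hl := by
          intro l hl h; subst h; exact (List.getLast_append_of_right_ne_nil _ _ (by simp)).symm
        exact key Q _ hQT
    · exact ⟨[], by simp, by simp, List.isChain_singleton _, List.nodup_singleton _, by simp, nv', h1, h2, by simpa using h3, h4⟩
  obtain ⟨A', hA'sub, hA'ρ, hA'ch, hA'nd, hA'Y, nu', hnu'1, hnu'2, hA'head, hYu'⟩ := hAex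
  obtain ⟨T', hT'sub, hT'ρ, hT'ch, hT'nd, hT'Y, nv', hnv'2, hnv'L, hT'last, hYv'⟩ := hTex
  -- the spliced path
  set P' := A' ++ Snew ++ T' with hP'
  have hP'ne : P' ≠ [] := by simp [hP', hSnew_ne]
  have hP'mem : ∀ x ∈ P', x ∈ A' ∨ x ∈ Snew ∨ x ∈ T' := fun x hx => by simpa [hP', or_assoc] using hx
  have hP'GB : ∀ x ∈ P', x ∈ D.verts ∧ σ x ≠ CLHexState.B := by
    intro x hx
    rcases hP'mem x hx with h | h | h
    · have hQ' : x ∈ Q := by rw [hQeq']; exact List.mem_append_left _ (hA'sub _ h)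
      exact ⟨hQG _ hQ', hQB _ hQ'⟩
    · exact hSnew_GB x h
    · have hQ' : x ∈ Q := by rw [hQeq']; exact List.mem_append_right _ (hT'sub _ h)
      exact ⟨hQG _ hQ', hQB _ hQ'⟩
  refine cyc_false_of_reversed_dart D horb hiface hadm hleft hretG hbc0 hnotw hP'ne ?_ ?_ (fun x hx => (hP'GB x hx).1)
    (fun x hx => (hP'GB x hx).2) ?_ ?_ hnu'1 hnu'2 hnv'2 hnv'L ?_ hYu' ?_ hYv' (i := i) (by omega) hρi ?_
  · -- duplicate-free
    rw [hP', List.append_assoc, List.nodup_append]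
    refine ⟨(List.nodup_append.1 hA'nd).1, List.nodup_append.2 ⟨hSnew_nd, (List.nodup_cons.1 hT'nd).2, ?_⟩, ?_⟩
    · intro x hx y hy hxy
      subst hxy
      obtain ⟨k, hk1, hk2, rfl⟩ := hSnew_mem x hx
      by_cases hkr : k = r
      · subst hkr; exact hT'ρ hy
      · by_cases hkn : k = r + n
        · rw [hkn] at hy
          rcases hsA with hA | ⟨hA, -⟩
          · exact hdisj _ hA (hT'sub _ hy)
          · exact hA (by rw [hQeq']; exact List.mem_append_right _ (hT'sub _ hy))
        · exact hmidQ k (by omega) (by omega) (by rw [hQeq']; exact List.mem_append_right _ (hT'sub _ hy))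
    · intro x hx y hy hxy
      subst hxy
      rcases List.mem_append.1 hy with hy | hy
      · obtain ⟨k, hk1, hk2, rfl⟩ := hSnew_mem x hy
        by_cases hkn : k = r + n
        · subst hkn; exact hA'ρ hx
        · by_cases hkr : k = r
          · rw [hkr] at hx
            rcases hrT with hT | ⟨hT, -⟩
            · exact hdisj _ (hA'sub _ hx) hT
            · exact hT (by rw [hQeq']; exact List.mem_append_left _ (hA'sub _ hx))
          · exact hmidQ k (by omega) (by omega) (by rw [hQeq']; exact List.mem_append_left _ (hA'sub _ hx))
      · exact hdisj _ (hA'sub _ hx) (hT'sub _ hy)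
  · -- a chain
    rw [hP']
    refine List.IsChain.append (List.IsChain.append ((List.isChain_append.1 hA'ch).1) hSnew_ch ?_)
      ((List.isChain_cons.1 hT'ch).2) ?_
    · intro x hx y hy
      rw [List.head?_eq_some_head hSnew_ne, Option.mem_def, Option.some.injEq] at hy
      subst hy
      rw [hSnew_head]
      exact (List.isChain_append.1 hA'ch).2.2 x hx _ (by simp)
    · intro x hx y hy
      rw [List.getLast?_eq_some_getLast (by simp [hSnew_ne]), Option.mem_def, Option.some.injEq] at hx
      subst hx
      rw [List.getLast_append_of_right_ne_nil _ _ hSnew_ne, hSnew_last]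
      exact (List.isChain_cons.1 hT'ch).1 y hy
  · -- yellow darts: by bonds
    intro d hd
    have h3 := (TriMarkedDomain.exists_mem_pathDarts_three_iff hSnew_ne (L₁ := A') (L₂ := T') (e := s(d.1, d.2))).1 ⟨d, hd, rfl⟩
    rw [hSnew_head, hSnew_last] at h3
    have key : ∀ {X : List (Site 2)}, (∀ d' ∈ pathDarts X, (clYellowGraph σ).Adj d'.1 d'.2) →
        (∃ d' ∈ pathDarts X, s(d.1, d.2) = s(d'.1, d'.2)) → (clYellowGraph σ).Adj d.1 d.2 := by
      intro X hX ⟨d', hd', he⟩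
      have h' := hX d' hd'
      rcases Sym2.eq_iff.1 he with ⟨h1, h2⟩ | ⟨h1, h2⟩
      · rw [h1, h2]; exact h'
      · rw [h1, h2]; exact h'.symm
    rcases h3 with h | h | h
    · exact key hA'Y h
    · exact key hSnew_Y h
    · exact key hT'Y h
  · -- at least two sites
    rw [hP', List.length_append, List.length_append]; omega
  · -- the start
    rw [← hA'head]
    simp only [hP', List.append_assoc]
    cases A' with
    | nil => simp only [List.nil_append, List.head_cons]; rw [List.head_append_of_ne_nil hSnew_ne, hSnew_head]
    | cons y ys => rfl
  · -- the end
    rw [← hT'last]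
    simp only [hP']
    by_cases hT0 : T' = []
    · subst hT0
      simp only [List.append_nil, List.getLast_singleton]
      rw [List.getLast_append_of_right_ne_nil _ _ hSnew_ne, hSnew_last]
    · simp only [List.getLast_append_of_right_ne_nil _ _ hT0, List.getLast_cons hT0]
  · -- the reversed necklace dart
    rw [hP', List.append_assoc]
    by_cases hA0 : A' = []
    · rw [hA0, List.nil_append]
      by_cases hT0 : T' = []
      · rw [hT0, List.append_nil]; exact hSnew_dart
      · rw [pathDarts_append hSnew_ne hT0]; exact List.mem_append_left _ hSnew_dart
    · rw [pathDarts_append hA0 (by simp [hSnew_ne])]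
      refine List.mem_append_right _ (List.mem_cons_of_mem _ ?_)
      by_cases hT0 : T' = []
      · rw [hT0, List.append_nil]; exact hSnew_dart
      · rw [pathDarts_append hSnew_ne hT0]; exact List.mem_append_left _ hSnew_dart

end Main

end Summit.CriticalPhenomena.CardyFormulaZ2.Theorems.BondTriangularCardyLine.KiteB
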